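import Summits.QuantumFields.YangMills.Theorems.EntropyBudgetEquipartitionFreeEnergyRateUnitaryRateShapes

/-!
# Chatterjee's Theorem 2.1 for `U(N)` WITH A POWER RATE — part 2b: the rate, cube and torus form

Helper for the crux `FreeEnergyRate` (stmt-QuantumFields-22402) of route `EntropyBudgetEquipartition` (part 1
`…UnitaryRateBounds`: the quantified Lemmas 17.4 / 17.7; part 2a `…UnitaryRateShapes`: the error shapes and the
absorption lemma). Here every explicit error term is absorbed into one negative power of `β`:

* `T_rate` (**Theorem 2.1 for `U(N)` with a power rate, cube form**): for `d ≥ 2`, `N ≥ 1` there is `β₀` with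
  `|T(B_n, β) − A| ≤ 9 β^{−b/2}` for all `β ≥ β₀` and all cube sides `n ≥ β` (`b = bL d = 1/(40(d+2))`,
  `A = (d−1) log c_H + N² L_d`);
* `unitary_freeEnergyDensity_rate` (**torus form**): `|f(β) + ((d−1)/2) N² log β − A| ≤ 9 β^{−b/2}` for `β ≥ β₀`,
  where `f = freeEnergyDensity d (unitaryFundamentalRep (Fin N) ℂ)` is the torus free energy density of
  `LatticeGaugeDLR` (the quantity of the crux), by `n → ∞` in `T_rate` (tree: cube free energies → `f`,
  `ChatterjeeFreeEnergy.tendsto_freeEnergyPerSite_halfOpenBox`; `coef n → d − 1`);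
* `unitary_freeEnergyDensity_rate_four`: the `d = 4` instance, `|f(β) + (3N²/2) log β − K| ≤ C β^{−κ}` — the exact
  shape of `FreeEnergyRate`'s body for the unitary model `U(N)` (`dim U(N) = N²`).

HONEST LABEL: `U(N)` is not compact SIMPLE, so this does not instantiate the crux (which quantifies over abstract
compact simple `G` with a faithful unitary `r`; the missing input there is a Lie chart of `r(G) ⊂ U(N)` with its Haar
density, not the rate). It is the K1 mechanism with a power rate, kernel-checked for the models the tree can chart.
Nothing here bears on the Clay mass gap; the route serves the RECORD-label rung R2ξ-G `XiPow` (an UPPER bound on the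
lattice gap).

References: S. Chatterjee, *The leading term of the Yang–Mills free energy*, J. Funct. Anal. 271 (2016),
arXiv:1602.01222, Thm. 2.1 / Thm. 1.1 and §17 (no rate in print; the power rate is new bookkeeping on the printed
proof plus the rate for Thm. 15.2).
-/

noncomputable section

namespace Summit.QuantumFields.YangMills.Theorems.FreeEnergyRate

open Filter Topology
open scoped NNReal
open Literature.MathematicalPhysics.QuantumLattice (unitaryFundamentalRep continuous_unitaryFundamentalRep
  freeEnergyDensity)
open Literature.MathematicalPhysics.QuantumFieldTheory
open Literature.MathematicalPhysics.QuantumFieldTheory.UnitaryCayley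
open Literature.MathematicalPhysics.QuantumFieldTheory.WilsonWeakCoupling
open Literature.MathematicalPhysics.QuantumFieldTheory.LatticeMaxwell
open Literature.MathematicalPhysics.QuantumFieldTheory.ChatterjeeAssembly
open Literature.MathematicalPhysics.QuantumFieldTheory.ChatterjeeFreeEnergy
open Literature.MathematicalPhysics.QuantumFieldTheory.ChatterjeeJointLimit

variable {d N : ℕ}

/-! ### §4c. Theorem 2.1 for `U(N)` with a power rate (cube form) -/

/-- The exponent bookkeeping: `q = b/2` is below every error exponent. [folklore] -/
theorem bL_half_lt_all :
    bL d / 2 < aU d / 2 / 2 ∧ bL d / 2 < aU d / 2 ∧ 2 * (bL d / 2) < 1 / 2 ∧ bL d / 2 < 1 / 2 ∧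
      bL d / 2 < 1 / 5 ∧ bL d / 2 < bL d ∧ bL d / 2 < cL d - bL d ∧ bL d / 2 < 1 - bL d := by
  have hd0 : (0 : ℝ) ≤ d := Nat.cast_nonneg d
  have hb := bL_pos (d := d)
  have h1 : bL d / 2 < aU d / 2 / 2 := by
    unfold bL aU
    rw [div_div, div_div, div_div, one_div_lt_one_div (by positivity) (by positivity)]
    nlinarith
  have h2 : bL d < 1 / 4 := by
    unfold bL
    rw [one_div_lt_one_div (by positivity) (by positivity)]
    nlinarith
  have h3 : cL d = 4 * bL d := by
    unfold cL bL
    field_simp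
    ring
  have ha := aU_pos (d := d)
  refine ⟨h1, by linarith, by linarith, by linarith, by linarith, by linarith, by rw [h3]; linarith, by linarith⟩

/-- **Theorem 2.1 for `U(N)` with a power rate (cube form).** For `d ≥ 2`, `N ≥ 1` and `log Z_M(B_n)/n^d → L`:
there is `β₀` such that for all `β ≥ β₀` and all cube sides `n ≥ β`,
`|T(B_n, β) − A| ≤ 5 β^{−b/2}`, `A = (d−1) log c_H + N² L`, `b = bL d = 1/(40(d+2))`.
[cite: arXiv160201222, Thm. 2.1 (power rate not in print)] -/
theorem T_rate (hd : 2 ≤ d) (hN : 1 ≤ N) {L : ℝ}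
    (hL : Tendsto (fun n : ℕ => logZM d n / (n : ℝ) ^ d) atTop (𝓝 L)) {A : ℝ}
    (hA : A = ((d : ℝ) - 1) * Real.log ((haarChartConst N : ℝ≥0) : ℝ) + (N : ℝ) ^ 2 * L) :
    ∃ β₀ : ℝ, ∀ β : ℝ, β₀ ≤ β → ∀ n : ℕ, β ≤ (n : ℝ) → |T d N n β - A| ≤ 5 * β ^ (-(bL d / 2)) := by
  have hd1 : 1 ≤ d := by omega
  set q : ℝ := bL d / 2 with hqdef
  obtain ⟨hq1, hq2, hq3, hq4, hq5, hq6, hq7, hq8⟩ := bL_half_lt_all (d := d)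
  set cG : ℝ := ((d : ℝ) + 1) * |Real.log ((haarChartConst N : ℝ≥0) : ℝ)| +
      3 * (N : ℝ) ^ 2 * (4 * Cke d * (9 * d + 13)) with hcG
  -- thresholds in `β` (as in the tree's Lemmas 17.4 / 17.7)
  have hth : ∀ᶠ β : ℝ in atTop, 2 ≤ β ∧ Vf d (C71 d N) β ≤ 1 / 64 ∧ 2 ≤ β ^ (aU d / 2) ∧
      β ^ (-(2 / 5 : ℝ)) ≤ 1 / 2 ∧ (N : ℝ) ≤ β ^ (1 / 10 : ℝ) ∧
      Rbfun d (bL d) β / β ^ (1 / 10 : ℝ) ≤ 1 / N ∧ 4 ≤ β ^ bL d ∧ 4 ≤ β ^ (1 - bL d) := by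
    refine (eventually_ge_atTop 2).and (Eventually.and ?_ (Eventually.and ?_ (Eventually.and ?_
      (Eventually.and ?_ (Eventually.and ?_ (Eventually.and ?_ ?_))))))
    · exact (tendsto_Vf (d := d) (C71 d N)).eventually (ge_mem_nhds (by norm_num))
    · exact (tendsto_rpow_atTop (by have := aU_pos (d := d); positivity)).eventually_ge_atTop _
    · exact (tendsto_rpow_neg_atTop (by norm_num : (0 : ℝ) < 2 / 5)).eventually (ge_mem_nhds (by norm_num))
    · exact (tendsto_rpow_atTop (by norm_num : (0 : ℝ) < 1 / 10)).eventually_ge_atTop _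
    · exact (tendsto_Rbfun_div (d := d) hd1 bL_pos.le bL_mul_lt).eventually
        (ge_mem_nhds (by have hN0 : (0 : ℝ) < N := (by exact_mod_cast hN); positivity))
    · exact (tendsto_rpow_atTop (bL_pos (d := d))).eventually_ge_atTop _
    · exact (tendsto_rpow_atTop (by linarith [bL_lt_one (d := d)] : (0 : ℝ) < 1 - bL d)).eventually_ge_atTop _
  -- dominations of the nine error shapes by `β^{-q}`
  have hdom : ∀ᶠ β : ℝ in atTop,
      cG * Real.sqrt 2 * β ^ (-(aU d / 2 / 2)) * (Real.log β + 1) ^ 0 ≤ 1 * β ^ (-q) ∧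
      2 * Real.log 2 * β ^ (-(aU d / 2)) * (Real.log β + 1) ^ 0 ≤ 1 * β ^ (-q) ∧
      (67 ^ 2 * 64 * (N : ℝ) ^ 2 * (d : ℝ) ^ 4 * (2 * d * (C71 d N + Real.log 2)) ^ 3) *
          β ^ (-(1 / 2 : ℝ)) * (Real.log β + 1) ^ 3 ≤ 1 * β ^ (-(2 * q)) ∧
      2 * K₂ d N * β ^ (-(aU d / 2)) * (Real.log β + 1) ^ 1 ≤ 1 * β ^ (-q) ∧
      cG * β ^ (-(1 / 2 : ℝ)) * (Real.log β + 1) ^ 0 ≤ 1 * β ^ (-q) ∧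
      (3 * d * (N : ℝ) ^ 2 + 67 * (d : ℝ) ^ 2 * N) * β ^ (-(1 / 5 : ℝ)) * (Real.log β + 1) ^ 0 ≤ 1 * β ^ (-q) ∧
      (N : ℝ) ^ 2 * (2 * Real.log 2 + 8 * (d : ℝ) ^ 2 *
          ((2 * d + 1) * (Real.log 3 + 3) + (Real.log d + 8 * (d : ℝ) ^ 2 + 2))) *
        β ^ (-(bL d)) * (Real.log β + 1) ^ 1 ≤ 1 * β ^ (-q) ∧
      K₃ d N * β ^ (-(cL d - bL d)) * (Real.log β + 1) ^ 1 ≤ 1 * β ^ (-q) ∧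
      (((d : ℝ) + 3 * d * 2 ^ (d - 1)) * (Kc d N + d * (N : ℝ) ^ 2 / 2) + ((d : ℝ) + 1) * (N : ℝ) ^ 2 +
          2 ^ (d + 1) * ((d : ℝ) + 2) * N * (d : ℝ) ^ 2) * β ^ (-(1 - bL d)) * (Real.log β + 1) ^ 1 ≤
        1 * β ^ (-q) := by
    refine (eventually_mul_rpow_neg_mul_log_pow_le _ hq1 0 one_pos).and
      ((eventually_mul_rpow_neg_mul_log_pow_le _ hq2 0 one_pos).and
      ((eventually_mul_rpow_neg_mul_log_pow_le _ hq3 3 one_pos).and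
      ((eventually_mul_rpow_neg_mul_log_pow_le _ hq2 1 one_pos).and
      ((eventually_mul_rpow_neg_mul_log_pow_le _ hq4 0 one_pos).and
      ((eventually_mul_rpow_neg_mul_log_pow_le _ hq5 0 one_pos).and
      ((eventually_mul_rpow_neg_mul_log_pow_le _ hq6 1 one_pos).and
      ((eventually_mul_rpow_neg_mul_log_pow_le _ hq7 1 one_pos).and
      (eventually_mul_rpow_neg_mul_log_pow_le _ hq8 1 one_pos))))))))
  obtain ⟨β₀, hβ₀⟩ := eventually_atTop.1 (hth.and hdom)
  refine ⟨β₀, fun β hβ n hn => ?_⟩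
  obtain ⟨⟨hβ2, hV, hu2, hr2, hN10, hRb, hb4, h4⟩, u1, u2, u3, u4, l1, l2, l3, l4, l5⟩ := hβ₀ β hβ
  have hβ1 : 1 ≤ β := by linarith
  have hβ0 : 0 < β := by linarith
  have hq0 : 0 ≤ β ^ (-q) := Real.rpow_nonneg hβ0.le _
  rw [one_mul] at u1 u2 u3 u4 l1 l2 l3 l4 l5
  -- `n ≥ β ≥ β^{a/2}`
  have hnu : β ^ (aU d / 2) ≤ n := by
    have : β ^ (aU d / 2) ≤ β ^ (1 : ℝ) :=
      Real.rpow_le_rpow_of_exponent_le hβ1 (by have := aU_le (d := d); linarith)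
    rw [Real.rpow_one] at this
    exact this.trans hn
  have upper := T_le_lim_add (N := N) hd hL hA hcG hβ2 hV hu2 hnu
  have lower := lim_sub_le_T hd hN hL hA hcG hβ2 hr2 hN10 hRb hb4 h4 hn
  -- upper error terms
  have eU1 : cG * Real.sqrt 2 / Real.sqrt (β ^ (aU d / 2)) ≤ β ^ (-q) := by
    rw [sqrt_rpow_eq hβ0, div_rpow_eq_shape hβ0]; exact u1
  have eU2 : 2 * Real.log 2 / β ^ (aU d / 2) ≤ β ^ (-q) := by
    rw [div_rpow_eq_shape hβ0]; exact u2
  have eU3 : Real.sqrt (67 ^ 2 * 64 * (N : ℝ) ^ 2 * (d : ℝ) ^ 4 * (max (Vf d (C71 d N) β) 0) ^ 3) ≤ β ^ (-q) := by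
    have hsq := (errU_sq_le_shape (d := d) (N := N) hβ1).trans u3
    have h2q : β ^ (-(2 * q)) = β ^ (-q * 2) := by congr 1; ring
    calc Real.sqrt (67 ^ 2 * 64 * (N : ℝ) ^ 2 * (d : ℝ) ^ 4 * (max (Vf d (C71 d N) β) 0) ^ 3)
        ≤ Real.sqrt (β ^ (-(2 * q))) := Real.sqrt_le_sqrt hsq
      _ = β ^ (-q) := by rw [h2q, sqrt_rpow_eq hβ0]; congr 1; ring
  have eU4 : K₂ d N * (2 * Real.log β / β ^ (aU d / 2)) ≤ β ^ (-q) := (K₂_term_le hβ1 _).trans u4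
  -- lower error terms
  have eL1 : cG / Real.sqrt β ≤ β ^ (-q) := by
    rw [Real.sqrt_eq_rpow, div_rpow_eq_shape hβ0]; exact l1
  have eL2 : e0 d N β ≤ β ^ (-q) := (e0_le_shape hβ1).trans l2
  have eL3 : errLB d N β ≤ β ^ (-q) := (errLB_le_shape (N := N) hd1 hβ1).trans l3
  have eL4 : K₃ d N * (β ^ bL d / β ^ cL d * Real.log β) ≤ β ^ (-q) := (K₃_term_le hβ1).trans l4
  have eL5 : JD d N β ≤ β ^ (-q) := (JD_le_shape hβ1).trans l5
  have hup : T d N n β - A ≤ 4 * β ^ (-q) := by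
    have h12 := add_le_add (add_le_add (add_le_add eU1 eU2) eU3) eU4
    linarith [upper, h12]
  have hlo : A - T d N n β ≤ 5 * β ^ (-q) := by
    have h15 := add_le_add (add_le_add (add_le_add (add_le_add eL1 eL2) eL3) eL4) eL5
    linarith [lower, h15]
  rw [abs_le]
  constructor <;> linarith

/-! ### §5. Transfer to the torus free energy density (the quantity of the crux) -/

/-- **Chatterjee's Theorem 1.1 for `U(N)` with a POWER RATE (torus free energy density).** For `d ≥ 2`, `N ≥ 1`
there are `K`, `κ > 0`, `C`, `β₀` with `|f(β) + ((d−1)/2)·N²·log β − K| ≤ C β^{−κ}` for all `β ≥ β₀`, where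
`f = freeEnergyDensity d (unitaryFundamentalRep (Fin N) ℂ)` is the torus free energy density of `LatticeGaugeDLR`;
explicitly `K = (d−1) log c_H + N² L_d`, `κ = 1/(80(d+2))`, `C = 5`. Proof: `T_rate` and `n → ∞`
(`ChatterjeeFreeEnergy.tendsto_freeEnergyPerSite_halfOpenBox`, `tendsto_coef`).
[cite: arXiv160201222, Thm. 1.1 (power rate not in print)] -/
theorem unitary_freeEnergyDensity_rate (hd : 2 ≤ d) (hN : 1 ≤ N) :
    ∃ K κ C β₀ : ℝ, 0 < κ ∧ ∀ β : ℝ, β₀ ≤ β →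
      |freeEnergyDensity d (unitaryFundamentalRep (Fin N) ℂ) β +
          ((d : ℝ) - 1) / 2 * (N : ℝ) ^ 2 * Real.log β - K| ≤ C * β ^ (-κ) := by
  have hd1 : 1 ≤ d := by omega
  obtain ⟨L, hL⟩ := tendsto_logZM_div (d := d) hd1
  set A : ℝ := ((d : ℝ) - 1) * Real.log ((haarChartConst N : ℝ≥0) : ℝ) + (N : ℝ) ^ 2 * L with hA
  obtain ⟨β₀, h⟩ := T_rate hd hN hL hA
  refine ⟨A, bL d / 2, 5, β₀, by have := bL_pos (d := d); positivity, fun β hβ => ?_⟩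
  have hρ : Continuous (unitaryFundamentalRep (Fin N) ℂ) := continuous_unitaryFundamentalRep (Fin N) ℂ
  have hF : Tendsto (fun n : ℕ => F d N n β) atTop
      (𝓝 (freeEnergyDensity d (unitaryFundamentalRep (Fin N) ℂ) β)) :=
    tendsto_freeEnergyPerSite_halfOpenBox (unitaryFundamentalRep (Fin N) ℂ) hρ β
  have hT : Tendsto (fun n : ℕ => T d N n β) atTop
      (𝓝 (freeEnergyDensity d (unitaryFundamentalRep (Fin N) ℂ) β +
        ((d : ℝ) - 1) / 2 * (N : ℝ) ^ 2 * Real.log β)) := by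
    have hc := (((tendsto_coef hd1).div_const 2).mul_const ((N : ℝ) ^ 2)).mul_const (Real.log β)
    exact hF.add hc
  have hev : ∀ᶠ n : ℕ in atTop, |T d N n β - A| ≤ 5 * β ^ (-(bL d / 2)) :=
    eventually_atTop.2 ⟨⌈β⌉₊, fun n hn => h β hβ n ((Nat.le_ceil β).trans (by exact_mod_cast hn))⟩
  exact le_of_tendsto ((hT.sub_const A).abs) hev

/-- **The `d = 4` instance in the shape of the crux `FreeEnergyRate`** (for the unitary model `U(N)`, `N ≥ 1`,
`dim U(N) = N²`): `∃ K κ C β₀, 0 < κ ∧ ∀ β ≥ β₀, |freeEnergyDensity 4 ρ_{U(N)} β + (3N²/2) log β − K| ≤ C β^{−κ}`.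
`U(N)` is not simple, so this is a `--supports` helper, not the crux. [cite: arXiv160201222, Thm. 1.1 (power rate not in print)] -/
theorem unitary_freeEnergyDensity_rate_four (hN : 1 ≤ N) :
    ∃ K κ C β₀ : ℝ, 0 < κ ∧ ∀ β : ℝ, β₀ ≤ β →
      |freeEnergyDensity 4 (unitaryFundamentalRep (Fin N) ℂ) β +
          (3 * ((N : ℝ) ^ 2) / 2) * Real.log β - K| ≤ C * β ^ (-κ) := by
  obtain ⟨K, κ, C, β₀, hκ, h⟩ := unitary_freeEnergyDensity_rate (d := 4) (N := N) (by norm_num) hN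
  refine ⟨K, κ, C, β₀, hκ, fun β hβ => ?_⟩
  have := h β hβ
  convert this using 3
  push_cast
  ring

end Summit.QuantumFields.YangMills.Theorems.FreeEnergyRate

end
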